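import Literature.MathematicalPhysics.QuantumFieldTheory.Balaban1983to89.B8SockP5uEBodyNestedPer
import Literature.MathematicalPhysics.QuantumFieldTheory.Balaban1983to89.B8SockWindowsSrc
import Literature.MathematicalPhysics.QuantumFieldTheory.Balaban1983to89.B8SockP5uEProviderGamma
import Literature.MathematicalPhysics.QuantumFieldTheory.Balaban1983to89.B8TowerBondsPrinted
import Literature.MathematicalPhysics.QuantumFieldTheory.Balaban1983to89.T4TermwiseTorus

/-!
# `Balaban1983to89.B8SockSP5uNestedPer` — [Balaban1985RegularSpaces] Prop. 5 (1.109) p. 94 ∕ Thm 4 p. 95 («exactly one») at NESTED PERIODIC members: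
# THE N05 KNIT's UNIQUENESS SOCKET `SP5u` (binder :174–:194 of `B8Thm4CoreZdGF3HP2PerLanEGamma`, T5) SERVED, BY NAME AND VERBATIM, below one
# member-uniform pair of thresholds `(c_u, c_P)` — bricks U2 (provider at one member) + U3 (the member-indexed server) of the interface request
# B8-P5-NESTED-SERVER (uniqueness half), instance (i) «zero source»

statement-level skeleton of published theorems with citation tags; proofs where landed; nothing here is a claim about the Yang–Mills mass gap

T. Bałaban, *Spaces of regular gauge field configurations on a lattice and gauge fixing conditions*, Commun. Math. Phys. **99** (1985) 75–102
`[Balaban1985RegularSpaces]` ("B8"; printed page = PDF page + 74): Prop. 5 (1.106)–(1.110) p. 94 («c₂, c₃»; «Such a configuration u′ is unique in the domain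
|λ|, |Dλ|₍₋₁₎ < c₃»), Thm 4 p. 88 ∕ p. 95 (uniqueness paragraph), (1.67)–(1.69) p. 88, (1.29) p. 81, (1.31) + (1.35) p. 82, p. 77 («at least one end-point of b
belongs to Ω»; «Ω_j ⊂ T_η»), (1.5)–(1.6) p. 77, Prop. 3 p. 87, (1.57)–(1.62) pp. 86–87, §3 p. 98; [3] = [Balaban1985Averaging] Prop. 4 p. 38, (4) p. 18 (the torus
`T_η` as `P`-periodic data on `ηℤᵈ`); [4] = [Balaban1985BackgroundPropagators] Thm 3.1 p. 397, (3.24)–(3.25) p. 394, Thm 3.3 p. 398.  PDF held: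
`paper:balaban1985-cmp99-regular-spaces-gauge-fixing`.  STATUS: published, refereed.

CITATION HEADER (lean-in-tree rule).  Cell `lit-balaban`, seat `lit-balaban-p21` (gen 39), sub-row «G-B8-T2S» (R3 `stmt-QuantumFields-19200`, `--supports`, helper; the
consumers bear on `stmt-QuantumFields-27364`).  Interface request B8-P5-NESTED-SERVER (pub-ymgap dag-n05-c g17 INBOX l.41793, 2026-08-28; answered + commissioned
by lit-balaban lead g33, `lit-balaban-p21/WAKE-B8P5NestedServerUniq.md`): «(S-uniq) `SP5u` :174–:194 ((1.109) in the E currency: periodic competitors v = e^{iλ},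
w = e^{iμ} with ‖λ‖, (Lʲη)‖D_{U₀}λ‖ < cu, both solving `LanF` + `Restr129` at level k ⇒ v = w) … at the member `ι a : ZdIdx d L` and period `p a : ℕ` … the
cheapest server is stated for a GENERAL `LanF` … say which of the letters' laws are NOT yet served at nested Ω so N06 can see the list».

WHAT THIS FILE PROVES (two theorems, no `def`).
★ `sp5u_of_lettersUB_γ'_per` (U2) — the periodic twin of dag-n05-w4's `B8SockSP5uProviderSrcGammaPrime.sp5uE_of_lettersUB_src_γ'`: at ONE member given as raw data
`(η, k, Ω, Λs, Λb)` with `Ω 0 = univ`, class law «box ⊂ Ω_{j−1}» for `Λb`, tower law at truncation `k`, period `P : ℕ` with `Lᵏ ∣ P` and shift-invariant `Λ_j`: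
the `SP5u` TEXT at this member (T5's binder, `ι a ↦` the raw data, `p a ↦ P`; `Adm` and `LanF` ABSTRACT, `LanF` implying (1.38) `IsLandau138W` at the top level —
instance (i): `Iff.rfl`) FROM four displayed hypotheses: (a) ONE SUPPLIER `SLetUBper` of [4]'s uniqueness letters at the top structure `(k, Λs k, U₀)` for every
unitary `P`-PERIODIC `U₀` in the regime `α₀ ≤ c_L` — linear maps `g Δ q qs Aw c H′` with (U1) `g_leftB` AT PERIODIC bounded functions, (U2) `c_left'` AT
LEVEL-PERIODIC multipliers, readings `hΔ hqs hq hq0`, (P) `hGper hAw_per hHper` (G′ periodic-valued, 𝔄 level-periodic-valued, H′ periodicity-preserving), H′ laws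
`hH0 hH1 hH2`, (1.91) `hQH` AT LEVEL-PERIODIC families, G′ bounds `hG`, remainder `hRbd` — EXACTLY the letter binders of `B8Prop5UniqSectEWPer.hFP_unique_of_sectE_local_wb_per`
:101–:131 and :146–:148 (THE LIST FOR N06: none of these is served at nested `Ω_j` in lit-balaban today; the all-torus versions are the hybrid letters of
`B8Thm2TorusLettersPerConv` on `B8Thm2TorusLettersPer.LettersAtPer`); (b) `SH59` := T5's OWN periodicity-guarded sourced b9 socket text `SH59src` :150–:173 at this
member (class `Λb`; the knit passes the SAME term it passes to T5); (c) the windows family `hwin` (the consequent of `B8SockWindowsSrc.uniqWindows_of_guard_src` at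
source size `0`, `c_{DA} = 2dL²c⋆₈`) and (d) the γ windows family `hwinγ` (`B8SockP5uEProviderGamma.gammaWindows_of_guard`).  Proof = the `ℤᵈ` γ′ provider's, token
for token, on U1 `B8SockP5uEBodyNestedPer.sockP5uE_body_γ'_per` (the SH59-at-datum lines at `B₈` by `B₀ ≤ B₈` monotonicity; `c_{DA} ≥ dL²(c⋆₈ + 2γ′B₀(α₀+α₁))`
from `2γ′B₀ ≤ 5dLB₈`; `U₁ = U′^{u₁⁻¹}` periodic from `U₀, U′, u₁` periodic by `B8Thm2TorusSupplier.mgauge_periodic`; T5's `T4TermwiseTorus.IsPeriodic P` guards are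
the full-lattice form `x + (P:ℤ) • m`, read as such).
★★★ `sockP5uPer_of_lettersAtPerNested` (U3; dag-n05-c's requested name) — `∃ cu cP > 0` FIRST, functions of `(d, L, B₈, B₀′ᴴ, B₂′, B_G, B_R, c_L, c₅₉)` only
(`cu` := the radius of `uniqWindows_of_guard_src` — print's `c₃`; `cP := min(c_W, c_L, c₅₉, c_γ)` — print's `c₂`), THEN for every member `i : ZdIdx d L`, every
period `P : ℕ`, every `Φ`, `Adm`, `LanF` with `LanF U₀ φ i.k W → IsLandau138W L i.k i.η (i.Ω 0) (i.Λs i.k) U₀ W`, under the three laws of the periodic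
(1.5)-index (`i.Ω 0 = univ`, `Lᵏ ∣ P`, `i.Λs i.k j` invariant under `+ (P∕Lʲ) • e ι`), the supplier (a) at `(i, P)` and T5's `SH59src` text at `(i, P)` below
`c₅₉`: **T5's `SP5u` binder text :174–:194 at `(i, P)` VERBATIM** (class `towerBondsP L i.Ω (i.Λs m) ·`, laws `B8TowerBondsPrinted.ZdIdx.towerBondsP_laws i`).

HONEST SCOPE ∕ A6.  By-name re-assembly; 0 new estimates; Proposition 5 ∕ [4] ∕ Sect. E NOT re-proved; [4]'s letters (with their laws at periodic arguments) and
the knit's sourced b9 socket are HYPOTHESES (N06 content at nested members); no joint-satisfiability claim; `d ≥ 2`, `L ≥ 2`.  Instance (ii) of the request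
(Theorem 8's source, `IsLandau146W … f W`) is NOT covered: it needs a periodic SOURCED uniqueness engine (`B8Prop5UniqSectEWSrc` has no `…Per` twin).
Count-neutral; N05 NOT discharged; one finite `𝕋⁴` programme at fixed `ε`, Bałaban as printed; the Yang–Mills mass gap (Clay) is NOT proved by any of this —
nothing continuum ∕ ℝ⁴ ∕ OS.  No `sorry`, no `def`, no `… : Prop` fact, no `instance`, no `notation`.

RELATED IN THE TREE, NOT DUPLICATED: `B8SockSP5uProviderSrcGammaPrime` ∕ `B8SockSP5UniformThresholdsSrcGammaPrime` (dag-n05-w4; the `ℤᵈ` γ′ road), `B8Thm2TorusUniqPer`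
(t2s-1; all-torus storey), `B8SockP5uEBodyNestedPer` (this seat; U1, USED), `B8SockWindowsSrc` ∕ `B8SockP5uEProviderGamma` (windows; USED).
-/

noncomputable section

open NormedSpace

namespace Literature.MathematicalPhysics.QuantumFieldTheory.Balaban1983to89.B8SockSP5uNestedPer

open Complex (I)
open MatrixLog B7Prop1Explicit B7Prop2Explicit B7Prop1Local B7Eq92Concrete
open B7Prop2Explicit (C0 c2')
open B7Prop3Flat (c3)
open B7Prop10General (C6 C4G)
open B7Prop9Flat (C5')
open B7Eq78Linearization (conjR zdBlocking QprimeIter)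
open B8Ineq132 (covDerivFwd covDeriv InAk)
open B8Eq119TwistedAxial (Restr129 InAx bgT)
open B8Eq184Proof (gaugeExp cfgExp)
open B8Lemma1NonAbelian (mulCfg)
open B8Eq140Level (SideTouches)
open B8Eq146AExpansion (iEta expCfg)
open B8Ineq130 (tlo thi)
open B8Thm2LogB (blockTop)
open B8Eq138LandauZd (IsLandau138W covDivB covLap QT logCfg)
open B8Ineq125Concrete (C2p)
open B8Eq1117Concrete (XSpace)
open B8Eq155JBound (Jcur wsup wsup_nonneg)
open B7Prop4GeneralLevels (linCovIter)
open B8ScaledSupNorm (bondNorm msup msup_nonneg)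
open B8Prop5ContractionKLevel (Bd2 Mc Kc)
open B8LambdaSpaceKLevel (wt)
open B8Thm4AtLandau138 (mgauge_mgauge_inv)
open B8Thm2TorusSupplier (mgauge_periodic)
open B8SockP5uEBodyNestedPer (sockP5uE_body_γ'_per)
open B8SockWindowsSrc (uniqWindows_of_guard_src)
open B8SockP5uEProviderGamma (gammaWindows_of_guard)
open B8LeafModelZd (ZdIdx)
open B8TowerBondsPrinted (towerBondsP)
open T4TermwiseTorus (IsPeriodic)

-- `Site` alone could resolve to the torus sites of `Setup.lean`; re-export the `ℤ^d` sites of `B7Prop1Explicit`.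
export B7Prop1Explicit (Site)

variable {d : ℕ} {𝔸 : Type*} [CStarAlgebra 𝔸] [Nontrivial 𝔸]

/-! ## §1 (U2) The provider at one member given as raw data: letters, the knit's sourced b9 socket and the windows displayed -/

section Provider

variable {L : ℕ} {η : ℝ} {k : ℕ} {Ω : ℕ → Set (Site d)} {Λs : ℕ → ℕ → Set (Site d)} {Λb : ℕ → ℕ → Set (Site d × Fin d)}
  {B₀ B₀' B₈ B₀'H B₂' BG BR cL cP γ' α₄ cu : ℝ}

/-- ★ **THE KNIT's UNIQUENESS SOCKET `SP5u` (E CURRENCY, PERIODICITY-GUARDED) AT ONE NESTED PERIODIC `Ω 0 = univ` MEMBER, PROVIDED** (Prop. 5 (1.109) p. 94 used as on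
p. 95, on the torus §3 p. 98; the periodic twin of dag-n05-w4's `B8SockSP5uProviderSrcGammaPrime.sp5uE_of_lettersUB_src_γ'`): at a member `(η, k, Ω, Λs, Λb)` with
`Ω 0 = univ`, class law «box ⊂ Ω_{j−1}», tower law at truncation `k`, period `P` with `Lᵏ ∣ P` and shift-invariant `Λ_j` — for all `α₀, α₁ > 0` with
`α₀ + α₁ ≤ c_P`, all unitary `P`-PERIODIC `U₀, U′`, every admitted `φ`, under (1.33)–(1.35) (print's p. 77 one-end-point class) and (1.66)₀, for every unitary
`P`-periodic `u₁ = 1` off `Ω₀` with (1.29) whose `U₁ = U′^{u₁⁻¹}` satisfies `LanF U₀ φ k` and the (1.62)-shape at `c⋆₈ = 5dLB₈(α₀ + α₁)`: two `P`-periodic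
competitors `v = e^{iλ}`, `w = e^{iμ}` (`λ`, `μ` periodic) in print's domain «|λ|, |Dλ|₍₋₁₎ < c_u», both putting `U₁` in the `LanF`-gauge at level `k` with (1.29),
are EQUAL.  From: the ABSTRACT gauge predicate `LanF` implying (1.38) at the top level (`hLan138`; instance (i) «zero source» = `Iff.rfl`), ONE supplier `SLetUBper`
of [4]'s uniqueness letters at PERIODIC backgrounds with (U1)∕(U2)∕(1.91) at periodic arguments and the (P) laws, the knit's OWN guarded sourced b9 socket `SH59`
(T5's `SH59src` text at this member), and the displayed windows `hwin` (source size `0`, `c_{DA} = 2dL²c⋆₈`) and `hwinγ`.  Proof: U1 `sockP5uE_body_γ'_per` at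
`B₀ := B₈`, `Lan := LanF U₀ φ`, `Sa = Sg := γ′B₀(α₀ + α₁)`.
[cite: Balaban1985RegularSpaces, Prop. 5 (1.109) p.94, Thm 4 p.88 («exactly one»), p.95, (1.29) p.81, (1.35) p.82, p.77, (1.57)–(1.62) pp.86–87, §3 p.98; Balaban1985Averaging, (4) p.18; Balaban1985BackgroundPropagators, Thm 3.1 p.397, Thm 3.3 p.398] -/
theorem sp5u_of_lettersUB_γ'_per (hd2 : 2 ≤ d) (hL : 2 ≤ L) (hη : 0 < η) (hk : 1 ≤ k) (P : ℕ) (hΩ : ∀ j, Ω (j + 1) ⊆ Ω j) (hΩ0 : Ω 0 = Set.univ)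
    -- PRINT's box law: the locality box of a class bond of level `j` lies in `Ω_{j−1}` ((1.31); level 0: `Ω₀`)
    (hbox : ∀ m, m ≤ k → ∀ j, j ≤ m → ∀ c ∈ Λb m j, ∀ x, InBox (loK L j c.1) (bondHiK L j c.1 c.2) x → x ∈ Ω (j - 1))
    (hclass : ∀ m, m ≤ k → ∀ j, j ≤ m → ∀ c ∈ Λb m j,
      (c.1 ∈ Λs m j ∧ c.1 + e c.2 ∈ Λs m j) ∨
      (∃ j', j = j' + 1 ∧ (∀ x, (L : ℤ) • c.1 ≤ x → x ≤ (L : ℤ) • c.1 + blockTop L → x ∈ Λs m j') ∧ c.1 + e c.2 ∈ Λs m j) ∨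
      (∃ j', j = j' + 1 ∧ c.1 ∈ Λs m j ∧ (∀ x, (L : ℤ) • (c.1 + e c.2) ≤ x → x ≤ (L : ℤ) • (c.1 + e c.2) + blockTop L → x ∈ Λs m j')))
    (htower : ∀ j, j ≤ k → ∀ y ∈ Λs k j, ∀ x, InBox (tlo L y j) (thi L y j) x → x ∈ Ω j)
    -- the torus (§3 p. 98): `Lᵏ ∣ P`, the constraint sets `Λ_j` of truncation `k` are invariant under the period shifts `+ (P∕Lʲ) • e ι`
    (hPdiv : ((L : ℤ) ^ k ∣ (P : ℤ)))
    (hΛ : ∀ j, j ≤ k → ∀ (y : Site d) (ι : Fin d), y + ((P : ℤ) / (L : ℤ) ^ j) • e ι ∈ Λs k j ↔ y ∈ Λs k j)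
    (hB₀ : 0 < B₀) (hB₀' : 0 < B₀') (hB₀'H : 0 < B₀'H) (hB₂' : 0 ≤ B₂') (hBG : 0 ≤ BG) (hBR : 0 ≤ BR) (hγ' : 0 ≤ γ')
    (hB₀8 : B₀ ≤ B₈) (hγB : 5 * (d : ℝ) * L * B₀ + 2 * (γ' * B₀) ≤ 5 * (d : ℝ) * L * B₈) (hα₄ : 0 < α₄)
    -- (a) ONE SUPPLIER of [4]'s uniqueness letters at the top structure `(k, Λs k, U₀)` for PERIODIC backgrounds: (U1)∕(U2)∕(1.91) at periodic arguments, (P) laws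
    (SLetUBper : ∀ α₀ : ℝ, 0 < α₀ → α₀ ≤ cL → ∀ U₀ : Site d → Fin d → 𝔸ˣ, (∀ x κ, U₀ x κ ∈ unitaryUnits 𝔸) → IsPeriodic P U₀ → InAk L k η α₀ Ω U₀ →
      ∃ (g Δ : (Site d → 𝔸) →ₗ[ℂ] (Site d → 𝔸)) (q : (Site d → 𝔸) →ₗ[ℂ] (ℕ → Site d → 𝔸)) (qs : (ℕ → Site d → 𝔸) →ₗ[ℂ] (Site d → 𝔸))
        (Aw c : (ℕ → Site d → 𝔸) →ₗ[ℂ] (ℕ → Site d → 𝔸)) (H' : XSpace d k 𝔸 →ₗ[ℂ] (Site d → 𝔸)),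
        (∀ x : Site d → 𝔸, (∀ (z : Site d) (ι : Fin d), x (z + (P : ℤ) • e ι) = x z) → (∃ C : ℝ, ∀ y, ‖x y‖ ≤ C) →
          g (Δ x + qs (Aw (q x))) = x) ∧
        (∀ φ : ℕ → Site d → 𝔸, (∀ j, j ≤ k → ∀ (y : Site d) (ι : Fin d), φ j (y + ((P : ℤ) / (L : ℤ) ^ j) • e ι) = φ j y) →
          qs (c (q (g (g (qs φ))))) = qs φ) ∧
        (∀ (f : Site d → 𝔸), ∀ x ∈ Ω 0, Δ f x = covLap η U₀ ((Ω 0).indicator f) x) ∧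
        (∀ (μ : ℕ → Site d → 𝔸), ∀ x ∈ Ω 0, qs μ x = QT L k (Λs k) U₀ μ x) ∧
        (∀ (f : Site d → 𝔸) (j : ℕ), j ≤ k → ∀ y ∈ Λs k j, q f j y = QprimeIter (zdBlocking d L) (bgT L U₀) j f y) ∧
        (∀ (f : Site d → 𝔸) (j : ℕ) (y : Site d), ¬ (j ≤ k ∧ y ∈ Λs k j) → q f j y = 0) ∧
        (∀ (f : Site d → 𝔸) (z : Site d) (ι : Fin d), g f (z + (P : ℤ) • e ι) = g f z) ∧
        (∀ μ : ℕ → Site d → 𝔸, ∀ j, j ≤ k → ∀ (y : Site d) (ι : Fin d), Aw μ j (y + ((P : ℤ) / (L : ℤ) ^ j) • e ι) = Aw μ j y) ∧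
        (∀ (X : XSpace d k 𝔸) (x : Site d), ‖H' X x‖ ≤ B₀'H * ‖X‖) ∧
        (∀ j, j ≤ k → ∀ (X : XSpace d k 𝔸), ∀ p ∈ {b : Site d × Fin d | SideTouches (Ω j) b.1 b.2},
          wt L η j * ‖covDerivFwd η U₀ p.2 (H' X) p.1‖ ≤ B₀'H * ‖X‖) ∧
        (∀ X : XSpace d k 𝔸, Bd2 L η k Ω (covLap η U₀ (H' X)) (B₂' * ‖X‖)) ∧
        (∀ X : XSpace d k 𝔸, (∀ (p : Fin (k + 1) × Site d) (ι : Fin d), X (p.1, p.2 + ((P : ℤ) / (L : ℤ) ^ (p.1 : ℕ)) • e ι) = X p) →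
          ∀ (z : Site d) (ι : Fin d), H' X (z + (P : ℤ) • e ι) = H' X z) ∧
        (∀ (Y : XSpace d k 𝔸), (∀ (p : Fin (k + 1) × Site d) (ι : Fin d), Y (p.1, p.2 + ((P : ℤ) / (L : ℤ) ^ (p.1 : ℕ)) • e ι) = Y p) →
          ∀ (j : ℕ) (hj : j ≤ k) (y : Site d), y ∈ Λs k j →
          QprimeIter (zdBlocking d L) (bgT L U₀) j (H' Y) y = Y (⟨j, Nat.lt_succ_of_le hj⟩, y)) ∧
        (∀ (f : Site d → 𝔸) (r : ℝ), 0 ≤ r → Bd2 L η k Ω f r →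
          (∀ x, ‖g f x‖ ≤ BG * r) ∧ ∀ j, j ≤ k → ∀ p ∈ {b : Site d × Fin d | SideTouches (Ω j) b.1 b.2},
            wt L η j * ‖covDerivFwd η U₀ p.2 (g f) p.1‖ ≤ BG * r) ∧
        (∀ (f : Site d → 𝔸) (r : ℝ), 0 ≤ r → Bd2 L η k Ω f r → Bd2 L η k Ω (f - g (qs (c (q (g f))))) (BR * r)))
    (hcPL : cP ≤ cL)
    -- the admissibility and gauge predicates of the knit, ABSTRACT; the gauge predicate implies (1.38) at the top level (instance (i): `Iff.rfl`)
    {Φ : Type*} (Adm : Φ → (Site d → Fin d → 𝔸ˣ) → ℝ → ℝ → Prop) (LanF : (Site d → Fin d → 𝔸ˣ) → Φ → ℕ → (Site d → Fin d → 𝔸ˣ) → Prop)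
    (hLan138 : ∀ (U₀ : Site d → Fin d → 𝔸ˣ) (φ : Φ) (W : Site d → Fin d → 𝔸ˣ), LanF U₀ φ k W → IsLandau138W L k η (Ω 0) (Λs k) U₀ W)
    -- (b) THE KNIT's OWN SOURCED b9 SOCKET `SH59src` AT THIS MEMBER, PERIODICITY-GUARDED (T5's binder text :150–:173, class `Λb`)
    (SH59 : ∀ α₀ α₁ : ℝ, 0 < α₀ → 0 < α₁ → α₀ + α₁ ≤ cP →
      ∀ U₀ U' : Site d → Fin d → 𝔸ˣ, (∀ x κ, U₀ x κ ∈ unitaryUnits 𝔸) → (∀ x κ, U' x κ ∈ unitaryUnits 𝔸) →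
      IsPeriodic P U₀ → IsPeriodic P U' → ∀ φ : Φ, Adm φ U₀ α₀ α₁ →
      InAk L k η α₀ Ω U₀ → InAk L k η α₀ Ω (mulCfg U' U₀) → (∀ m, m ≤ k → InAx L m (Λs m) U₀ (mulCfg U' U₀)) →
      (∀ j, j ≤ k → ∀ (z : Site d) (μ : Fin d),
        ((∀ x, InBox (tlo L z j) (thi L z j) x → x ∈ Ω j) ∨ (∀ x, InBox (tlo L (z + e μ) j) (thi L (z + e μ) j) x → x ∈ Ω j)) →
        ‖(avgIter L (mulCfg U' U₀) j z μ : 𝔸) - (avgIter L U₀ j z μ : 𝔸)‖ ≤ α₁) →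
      (∀ b ∈ {b : Site d × Fin d | SideTouches (Ω 0) b.1 b.2}, ‖((U' b.1 b.2 : 𝔸ˣ) : 𝔸) - 1‖ ≤ α₁) →
      (∀ m, 1 ≤ m → m ≤ k → ∀ (u : Site d → 𝔸ˣ) (W : Site d → Fin d → 𝔸ˣ) (A' : Site d → Fin d → 𝔸),
        (∀ x, u x ∈ unitaryUnits 𝔸) → IsPeriodic P u → IsPeriodic P W → IsPeriodic P A' →
        mgauge U₀ u W = U' → Restr129 L m (Λs m) U₀ u → LanF U₀ φ m W →
        (∀ y τ, IsSelfAdjoint (A' y τ)) →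
        (∀ j, j ≤ m → ∀ y τ, SideTouches (Ω j) y τ →
        W y τ = cfgExp η A' y τ ∧ ‖A' y τ‖ ≤ (2 * (L * (5 * (d : ℝ) * L * B₈ * (α₀ + α₁))) + 8 * (8 * B₀' * (5 * (d : ℝ) * L * B₈) * (α₀ + α₁))) * ((L : ℝ) ^ j * η)⁻¹) →
        (∀ y τ, (∀ j, j ≤ m → ¬ SideTouches (Ω j) y τ) → A' y τ = 0) →
        msup L m η (-(1 : ℝ)) (fun j (b : Site d × Fin d) => SideTouches (Ω j) b.1 b.2) (fun b => A' b.1 b.2)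
        ≤ B₀ * (bondNorm L m η (-(3 : ℝ)) Ω (fun x μ => Jcur η U₀ A' μ x)
        + wsup 1 (fun p : {p : ℕ × (Site d × Fin d) // p.1 ≤ m ∧ p.2 ∈ Λb m p.1} =>
        linCovIter L U₀ (iEta η A') p.1.1 p.1.2.1 p.1.2.2)) + γ' * B₀ * (α₀ + α₁) ∧
        msup L m η (-(2 : ℝ)) (fun j (t : Fin d × Fin d × Site d) => SideTouches (Ω j) t.2.2 t.2.1)
        (fun t => covDerivFwd η U₀ t.1 (fun z => A' z t.2.1) t.2.2)
        ≤ B₀ * (bondNorm L m η (-(3 : ℝ)) Ω (fun x μ => Jcur η U₀ A' μ x)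
        + wsup 1 (fun p : {p : ℕ × (Site d × Fin d) // p.1 ≤ m ∧ p.2 ∈ Λb m p.1} =>
        linCovIter L U₀ (iEta η A') p.1.1 p.1.2.1 p.1.2.2)) + γ' * B₀ * (α₀ + α₁)))
    -- (c) the windows family below `c_P` (the consequent of `B8SockWindowsSrc.uniqWindows_of_guard_src` at source size `0`; `c_{DA} = 2dL²c⋆₈`)
    (hwin : ∀ α₀ α₁ : ℝ, 0 < α₀ → 0 < α₁ → α₀ + α₁ ≤ cP →
      ∀ cs cB cDA hE hE₂ lE lE₂ : ℝ, cs = 5 * (d : ℝ) * L * B₈ * (α₀ + α₁) → cB = L * cs → cDA = 2 * (d : ℝ) * (L : ℝ) ^ 2 * cs →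
      hE = B₀'H * (C2p d * (40 * d * cB + α₄) * α₄) → hE₂ = B₂' * (C2p d * (40 * d * cB + α₄) * α₄) →
      lE = B₀'H * (4 * C2p d * (40 * d * cB + 2 * α₄)) → lE₂ = B₂' * (4 * C2p d * (40 * d * cB + 2 * α₄)) →
      36 * d * B₈ * cs ≤ 1 / 2 ∧
      8 * (131072 * ((d : ℝ) + 1) ^ 2) * Real.exp (4 * (800 * ((d : ℝ) + 1) ^ 2 * ((d : ℝ) + 4)) * α₀) ≤ 16 * (131072 * ((d : ℝ) + 1) ^ 2) ∧
      2 * cs ^ 2 + 20 * d * α₀ * cs + 2 * (16 * (131072 * ((d : ℝ) + 1) ^ 2)) * cs ^ 2 ≤ α₀ + α₁ ∧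
      (d : ℝ) * L * α₁ ≤ 1 / 8 ∧
      C0 d * α₀ ≤ 1 / 3 ∧ 4 * α₀ ≤ c2' d L ∧
      Real.exp (4 * (800 * ((d : ℝ) + 1) ^ 2 * ((d : ℝ) + 4)) * α₀) * (1 + 8 * (131072 * ((d : ℝ) + 1) ^ 2) * cB) ≤ 2 ∧
      2 * cB ≤ c3 d L ∧ 2048 * (d : ℝ) * cB ≤ 1 ∧ 40 * d * cB ≤ 1 / 200 ∧
      200 * C6 d * (2 * α₄) ≤ 1 ∧ 12000 * ((d : ℝ) + 1) * L * (2 * α₄) ≤ 1 ∧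
      C4G d L * (α₀ + 40 * d * cB + 4 * (2 * α₄)) ≤ 1 ∧
      1024 * ((d : ℝ) + 1) * ((d : ℝ) + 4) * L ^ 2 * α₀ ≤ 1 ∧ 32 * ((d : ℝ) + 1) ^ 2 * C6 d * L ^ 2 * α₀ ≤ 1 ∧
      16 * d * C5' d * C6 d * (L : ℝ) ^ 2 * α₀ ≤ 1 ∧ 8 * d * C6 d * L * α₀ ≤ 1 ∧
      40 * d * cB + α₄ ≤ 1 / (4 * B₀'H * (2 * C2p d)) ∧ 2 * C6 d * (40 * d * cB + 4 * α₄) ≤ 1 / 8 ∧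
      cB ≤ 1 / 13 ∧ α₄ / 4 + hE ≤ 1 / 24 ∧ α₄ / 4 + hE ≤ 1 / 140 ∧ 10 * (α₄ / 4 + hE) * BR ≤ 1 / 2 ∧
      BG * Mc d BR (α₄ / 4 + hE) cB hE₂ cDA ≤ α₄ / 4 ∧
      BG * Kc d BR (α₄ / 4 + hE) cB hE₂ cDA lE₂ (1 + lE) (1 + lE) ≤ 1 / 2 ∧
      lE ≤ 1 / 2 ∧ cu + hE ≤ α₄ / 4)
    -- (d) EDITION γ: the γ windows family below `c_P` (`B8SockP5uEProviderGamma.gammaWindows_of_guard` at `B₈`)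
    (hwinγ : ∀ α₀ α₁ : ℝ, 0 < α₀ → 0 < α₁ → α₀ + α₁ ≤ cP →
      ∀ cs cB : ℝ, cs = 5 * (d : ℝ) * L * B₈ * (α₀ + α₁) → cB = L * cs →
      C0 d * ((L : ℝ) ^ 2 * α₀) ≤ 1 / 3 ∧ 4 * ((L : ℝ) ^ 2 * α₀) ≤ c2' d L ∧
      Real.exp (4 * (800 * ((d : ℝ) + 1) ^ 2 * ((d : ℝ) + 4)) * ((L : ℝ) ^ 2 * α₀)) * (1 + 8 * (131072 * ((d : ℝ) + 1) ^ 2) * cB) ≤ 2 ∧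
      8 * (131072 * ((d : ℝ) + 1) ^ 2) * Real.exp (4 * (800 * ((d : ℝ) + 1) ^ 2 * ((d : ℝ) + 4)) * ((L : ℝ) ^ 2 * α₀)) * (L : ℝ) ^ 2
        ≤ 16 * (131072 * ((d : ℝ) + 1) ^ 2) * (L : ℝ) ^ 2 ∧
      2 * cs ^ 2 + 20 * d * α₀ * cs + 2 * (16 * (131072 * ((d : ℝ) + 1) ^ 2) * (L : ℝ) ^ 2) * cs ^ 2 ≤ α₀ + α₁) :
    -- THE `SP5u` BINDER TEXT OF T5 AT THIS MEMBER (`ι a ↦ (η, k, Ω, Λs)`, `p a ↦ P`, `Adm a ↦ Adm`, `LanF a ↦ LanF`)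
    ∀ α₀ α₁ : ℝ, 0 < α₀ → 0 < α₁ → α₀ + α₁ ≤ cP →
      ∀ U₀ U' : Site d → Fin d → 𝔸ˣ, (∀ x κ, U₀ x κ ∈ unitaryUnits 𝔸) → (∀ x κ, U' x κ ∈ unitaryUnits 𝔸) →
      IsPeriodic P U₀ → IsPeriodic P U' → ∀ φ : Φ, Adm φ U₀ α₀ α₁ →
      InAk L k η α₀ Ω U₀ → InAk L k η α₀ Ω (mulCfg U' U₀) → (∀ m, m ≤ k → InAx L m (Λs m) U₀ (mulCfg U' U₀)) →
      (∀ j, j ≤ k → ∀ (z : Site d) (μ : Fin d),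
        ((∀ x, InBox (tlo L z j) (thi L z j) x → x ∈ Ω j) ∨ (∀ x, InBox (tlo L (z + e μ) j) (thi L (z + e μ) j) x → x ∈ Ω j)) →
        ‖(avgIter L (mulCfg U' U₀) j z μ : 𝔸) - (avgIter L U₀ j z μ : 𝔸)‖ ≤ α₁) →
      (∀ b ∈ {b : Site d × Fin d | SideTouches (Ω 0) b.1 b.2}, ‖((U' b.1 b.2 : 𝔸ˣ) : 𝔸) - 1‖ ≤ α₁) →
      ∀ u₁ : Site d → 𝔸ˣ, (∀ x, u₁ x ∈ unitaryUnits 𝔸) → (∀ x, x ∉ Ω 0 → u₁ x = 1) → IsPeriodic P u₁ → Restr129 L k (Λs k) U₀ u₁ →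
      LanF U₀ φ k (mgauge U₀ u₁⁻¹ U') →
      (∃ A₁ : Site d → Fin d → 𝔸, ∀ j, j ≤ k → ∀ (x : Site d) (κ : Fin d), SideTouches (Ω j) x κ →
        mgauge U₀ u₁⁻¹ U' x κ = cfgExp η A₁ x κ ∧ ‖A₁ x κ‖ ≤ (5 * (d : ℝ) * L * B₈ * (α₀ + α₁)) * ((L : ℝ) ^ j * η)⁻¹) →
      ∀ (v w : Site d → 𝔸ˣ) (lam mu : Site d → 𝔸),
      IsPeriodic P v → IsPeriodic P w → IsPeriodic P lam → IsPeriodic P mu →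
      (∀ x, ((gaugeExp lam x : 𝔸ˣ) : 𝔸) = ((v x : 𝔸ˣ) : 𝔸) ∧ IsSelfAdjoint (lam x) ∧ ‖lam x‖ < cu) → (∀ x, x ∉ Ω 0 → lam x = 0) →
      (∀ j, j ≤ k → ∀ b ∈ {b : Site d × Fin d | SideTouches (Ω j) b.1 b.2}, ((L : ℝ) ^ j * η) * ‖covDerivFwd η U₀ b.2 lam b.1‖ < cu) →
      (∀ x, ((gaugeExp mu x : 𝔸ˣ) : 𝔸) = ((w x : 𝔸ˣ) : 𝔸) ∧ IsSelfAdjoint (mu x) ∧ ‖mu x‖ < cu) → (∀ x, x ∉ Ω 0 → mu x = 0) →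
      (∀ j, j ≤ k → ∀ b ∈ {b : Site d × Fin d | SideTouches (Ω j) b.1 b.2}, ((L : ℝ) ^ j * η) * ‖covDerivFwd η U₀ b.2 mu b.1‖ < cu) →
      LanF U₀ φ k (mgauge U₀ v⁻¹ (mgauge U₀ u₁⁻¹ U')) → Restr129 L k (Λs k) U₀ (u₁ * v) →
      LanF U₀ φ k (mgauge U₀ w⁻¹ (mgauge U₀ u₁⁻¹ U')) → Restr129 L k (Λs k) U₀ (u₁ * w) →
      ∀ x, v x = w x := by
  intro α₀ α₁ hα₀ hα₁ hs U₀ U' hU₀ hU' hU₀per hU'per φ hφ h33 h34 hAx h135 h66 u₁ hu₁ _ hu₁per h129 hLan hdat v w lam mu _ _ hlP hmP hv _ hvD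
    hw _ hwD hLv hRv hLw hRw
  have hL1 : 1 ≤ L := le_trans (by norm_num) hL
  have hLr : (1 : ℝ) ≤ L := by exact_mod_cast hL1
  have hsum : 0 < α₀ + α₁ := add_pos hα₀ hα₁
  have hB₈ : 0 < B₈ := lt_of_lt_of_le hB₀ hB₀8
  -- the windows at this (α₀, α₁)
  obtain ⟨hside, -, -, hsmall₁, hα3, hα4, hsmall, hc₃, hsc, hα₃', hs₁, hs₂, hs₃, hs₄, hs₅, hs₆, hs₇, hsm, hprod8, hcA', ha₁',
    hb₁', hθ, h103, h106, hlE, hcu⟩ := hwin α₀ α₁ hα₀ hα₁ hs _ _ _ _ _ _ _ rfl rfl rfl rfl rfl rfl rfl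
  -- the γ windows at this (α₀, α₁) (the (1.56)-constant line and (1.61) are the γ ones)
  obtain ⟨hα3L, hα4L, hsmallL, hC₂L, h61L⟩ := hwinγ α₀ α₁ hα₀ hα₁ hs _ _ rfl rfl
  -- the letters at the top structure, at the PERIODIC background `U₀`
  have hα₀L : α₀ ≤ cL := by linarith only [hs, hcPL, hα₁]
  obtain ⟨g, Δ, q, qs, Aw, c, H', g_leftB, c_left', hΔ, hqs, hq, hq0, hGper, hAw_per, hH0, hH1, hH2, hHper, hQH, hG, hRbd⟩ :=
    SLetUBper α₀ hα₀ hα₀L U₀ hU₀ hU₀per h33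
  have hcs0 : 0 ≤ 5 * (d : ℝ) * L * B₈ * (α₀ + α₁) := by positivity
  -- the datum `U₁ = U′^{u₁⁻¹}`: `U′ = U₁^{u₁}`, and `U₁` is `P`-periodic (the guard of `SH59`)
  have hW : mgauge U₀ u₁ (mgauge U₀ u₁⁻¹ U') = U' := mgauge_mgauge_inv U₀ U' u₁
  have hWP : IsPeriodic P (mgauge U₀ u₁⁻¹ U') := fun x m => funext fun κ =>
    mgauge_periodic (p := (P : ℤ) • m) (fun y κ => by rw [hU₀per y m]) (fun y κ => by rw [hU'per y m])
      (fun y => by rw [Pi.inv_apply, Pi.inv_apply, hu₁per y m]) x κ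
  -- the SOURCED b9 lines at the datum, top level `k`, for every PERIODIC masked exponent, from `SH59` at `m = k` (monotonicity `B₀ ≤ B₈` on the
  -- non-negative bracket; the datum bound `c⋆₈` ≤ the socket's constant)
  have hSg : 0 ≤ γ' * B₀ * (α₀ + α₁) := by positivity
  have SH59k : ∀ A' : Site d → Fin d → 𝔸, (∀ x m : Site d, A' (x + (P : ℤ) • m) = A' x) → (∀ y τ, IsSelfAdjoint (A' y τ)) →
      (∀ j, j ≤ k → ∀ (y : Site d) (τ : Fin d), SideTouches (Ω j) y τ →
        mgauge U₀ u₁⁻¹ U' y τ = cfgExp η A' y τ ∧ ‖A' y τ‖ ≤ (5 * (d : ℝ) * L * B₈ * (α₀ + α₁)) * ((L : ℝ) ^ j * η)⁻¹) →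
      (∀ (y : Site d) (τ : Fin d), (∀ j, j ≤ k → ¬ SideTouches (Ω j) y τ) → A' y τ = 0) →
      msup L k η (-(1 : ℝ)) (fun j (b : Site d × Fin d) => SideTouches (Ω j) b.1 b.2) (fun b => A' b.1 b.2)
          ≤ B₈ * (bondNorm L k η (-(3 : ℝ)) Ω (fun x μ => Jcur η U₀ A' μ x)
          + wsup 1 (fun p : {p : ℕ × (Site d × Fin d) // p.1 ≤ k ∧ p.2 ∈ Λb k p.1} =>
          linCovIter L U₀ (iEta η A') p.1.1 p.1.2.1 p.1.2.2)) + γ' * B₀ * (α₀ + α₁) ∧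
        msup L k η (-(2 : ℝ)) (fun j (t : Fin d × Fin d × Site d) => SideTouches (Ω j) t.2.2 t.2.1)
          (fun t => covDerivFwd η U₀ t.1 (fun z => A' z t.2.1) t.2.2)
          ≤ B₈ * (bondNorm L k η (-(3 : ℝ)) Ω (fun x μ => Jcur η U₀ A' μ x)
          + wsup 1 (fun p : {p : ℕ × (Site d × Fin d) // p.1 ≤ k ∧ p.2 ∈ Λb k p.1} =>
          linCovIter L U₀ (iEta η A') p.1.1 p.1.2.1 p.1.2.2)) + γ' * B₀ * (α₀ + α₁) := by
    intro A' hA'P hsa' hWA' hA0'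
    have hbig : ∀ j, j ≤ k → ∀ (y : Site d) (τ : Fin d), SideTouches (Ω j) y τ →
        mgauge U₀ u₁⁻¹ U' y τ = cfgExp η A' y τ ∧ ‖A' y τ‖ ≤ (2 * (L * (5 * (d : ℝ) * L * B₈ * (α₀ + α₁))) +
          8 * (8 * B₀' * (5 * (d : ℝ) * L * B₈) * (α₀ + α₁))) * ((L : ℝ) ^ j * η)⁻¹ := by
      intro j hj y τ hsd
      obtain ⟨he, hb⟩ := hWA' j hj y τ hsd
      refine ⟨he, hb.trans (mul_le_mul_of_nonneg_right ?_ (by positivity))⟩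
      have h1 : (1 : ℝ) * (5 * (d : ℝ) * L * B₈ * (α₀ + α₁)) ≤ L * (5 * (d : ℝ) * L * B₈ * (α₀ + α₁)) :=
        mul_le_mul_of_nonneg_right hLr hcs0
      have h2 : 0 ≤ 8 * (8 * B₀' * (5 * (d : ℝ) * L * B₈) * (α₀ + α₁)) := by positivity
      linarith only [h1, h2, hcs0]
    obtain ⟨h1, h2⟩ := SH59 α₀ α₁ hα₀ hα₁ hs U₀ U' hU₀ hU' hU₀per hU'per φ hφ h33 h34 hAx h135 h66 k hk le_rfl u₁
      (mgauge U₀ u₁⁻¹ U') A' hu₁ hu₁per hWP hA'P hW h129 hLan hsa' hbig hA0'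
    have hX : 0 ≤ bondNorm L k η (-(3 : ℝ)) Ω (fun x μ => Jcur η U₀ A' μ x)
        + wsup 1 (fun p : {p : ℕ × (Site d × Fin d) // p.1 ≤ k ∧ p.2 ∈ Λb k p.1} =>
          linCovIter L U₀ (iEta η A') p.1.1 p.1.2.1 p.1.2.2) := by
      have ha : 0 ≤ bondNorm L k η (-(3 : ℝ)) Ω (fun x μ => Jcur η U₀ A' μ x) := by
        unfold bondNorm; exact msup_nonneg L k hη.le _ _ _
      have hb := wsup_nonneg zero_le_one (fun p : {p : ℕ × (Site d × Fin d) // p.1 ≤ k ∧ p.2 ∈ Λb k p.1} =>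
        linCovIter L U₀ (iEta η A') p.1.1 p.1.2.1 p.1.2.2)
      linarith only [ha, hb]
    have hmono := mul_le_mul_of_nonneg_right hB₀8 hX
    exact ⟨h1.trans (by linarith only [hmono]), h2.trans (by linarith only [hmono])⟩
  -- `c_{DA} = 2dL²c⋆₈ ≥ dL²(c⋆₈ + 2Sg)` since `2γ′B₀ ≤ 5dLB₈`
  have hcDAlo : (d : ℝ) * (L : ℝ) ^ 2 * (5 * (d : ℝ) * L * B₈ * (α₀ + α₁) + 2 * (γ' * B₀ * (α₀ + α₁))) ≤
      2 * (d : ℝ) * (L : ℝ) ^ 2 * (5 * (d : ℝ) * L * B₈ * (α₀ + α₁)) := by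
    have hγB' : 2 * (γ' * B₀) ≤ 5 * (d : ℝ) * L * B₈ := by
      have h0 : 0 ≤ 5 * (d : ℝ) * L * B₀ := by positivity
      linarith only [hγB, h0]
    have h1 : 2 * (γ' * B₀ * (α₀ + α₁)) ≤ 5 * (d : ℝ) * L * B₈ * (α₀ + α₁) := by
      have h := mul_le_mul_of_nonneg_right hγB' hsum.le
      linarith only [h]
    have h2 : (0 : ℝ) ≤ (d : ℝ) * (L : ℝ) ^ 2 := by positivity
    have h3 := mul_le_mul_of_nonneg_left h1 h2
    linarith only [h3]
  -- the torus data of U1: every `Lʲ ∣ P`, `j ≤ k`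
  have hdivP : ∀ j, j ≤ k → ((L : ℤ) ^ j ∣ (P : ℤ)) := fun j hj => (pow_dvd_pow (L : ℤ) hj).trans hPdiv
  -- U1 (`sockP5uE_body_γ'_per`) at `B₀ := B₈`, `Lan := LanF U₀ φ`, `Sa = Sg := γ′B₀(α₀ + α₁)`; the competitors' conditions at the top level are (1.38) by `hLan138`
  exact sockP5uE_body_γ'_per hd2 hL hη hk (P : ℤ) hΩ hΩ0 hbox hclass htower hdivP hΛ hα₀ hα₁ hB₈ rfl hα₄ hU₀ hU' hU₀per hU'per h33 h34 hAx h135 hu₁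
    hu₁per h129 (fun n W => LanF U₀ φ n W) hLan hdat hSg SH59k hside hC₂L h61L hsmall₁ g Δ q qs Aw c g_leftB c_left' hΔ hqs hq hq0 hGper hAw_per
    H' hB₀'H hB₂' hBG hBR hH0 hH1 hH2 hHper hQH hG hRbd le_rfl le_rfl hcDAlo hα3 hα4 hα3L hα4L hsmallL hsmall hc₃ hsc hα₃' hs₁ hs₂ hs₃ hs₄ hs₅
    hs₆ hs₇ hsm hprod8 rfl rfl rfl rfl hcA' ha₁' hb₁' hθ h103 h106 hlE hcu hlP hmP hv hvD hw hwD (hLan138 _ _ _ hLv) hRv (hLan138 _ _ _ hLw) hRw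

end Provider

/-! ## §2 (U3) The member-indexed server below one member-uniform pair of thresholds — T5's `SP5u` text at `(i, P)` verbatim -/

section Server

variable {L : ℕ} {B₀ B₀' B₈ B₀'H B₂' BG BR cL γ' c59 : ℝ}

/-- ★★★ **THE N05 KNIT's UNIQUENESS SOCKET `SP5u` SERVED AT NESTED PERIODIC MEMBERS, BELOW ONE MEMBER-UNIFORM PAIR OF THRESHOLDS** (Prop. 5 p. 94: «There exist
positive constants c₂, c₃, depending on d and L only … Such a configuration u′ is unique in the domain |λ|, |Dλ|₍₋₁₎ < c₃» (1.109); Thm 4 p. 95; on the torus §3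
p. 98): `∃ cu cP > 0` FIRST — functions of `(d, L, B₈, B₀′ᴴ, B₂′, B_G, B_R, c_L, c₅₉)` only (`cu` := the radius of `B8SockWindowsSrc.uniqWindows_of_guard_src`,
`cP := min(c_W, c_L, c₅₉, c_γ)` with `c_γ(d, L, B₈)` of `gammaWindows_of_guard`) — THEN at every member `i : ZdIdx d L` and period `P : ℕ`, for every
`Φ`, `Adm`, `LanF` whose top-level gauge condition implies (1.38) (`LanF U₀ φ i.k W → IsLandau138W L i.k i.η (i.Ω 0) (i.Λs i.k) U₀ W`; instance (i)
«zero source»: `Iff.rfl`), under the three laws of the periodic (1.5)-index (`i.Ω 0 = univ`; `Lᵏ ∣ P`; `i.Λs i.k j` invariant under the period shifts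
`+ (P∕Lʲ) • e ι`, `j ≤ k`), the supplier `SLetUBper` of [4]'s uniqueness letters at `(i, P)` (laws at periodic arguments, regime `α₀ ≤ c_L`) and T5's own
guarded sourced b9 socket text `SH59src` at `(i, P)` below `c₅₉` (class `towerBondsP L i.Ω (i.Λs m) ·`): **T5's `SP5u` binder text
(`B8Thm4CoreZdGF3HP2PerLanEGamma.thm4Core_zdGF3HP₂Per_map_lanE_γ'` :174–:194) at `(i, P)` VERBATIM.**  Proof: U2 `sp5u_of_lettersUB_γ'_per` at the member's own
tower (`B8TowerBondsPrinted.ZdIdx.towerBondsP_laws i`), the windows discharged by `uniqWindows_of_guard_src` (source size `0`) and `gammaWindows_of_guard`.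
[cite: Balaban1985RegularSpaces, Prop. 5 (1.109) p.94 («c₂, c₃»), Thm 4 p.88 («exactly one»), p.95, (1.5)–(1.6) p.77, (1.31) p.82, §3 p.98; Balaban1985Averaging, (4) p.18; Balaban1985BackgroundPropagators, Thm 3.1 p.397, Thm 3.3 p.398] -/
theorem sockP5uPer_of_lettersAtPerNested (hd2 : 2 ≤ d) (hL : 2 ≤ L) (hB : 2 ≤ 5 * (d : ℝ) * L * B₈) (hcL : 0 < cL) (hB₀ : 0 < B₀) (hB₀' : 0 < B₀')
    (hB₀'H : 0 < B₀'H) (hB₂' : 0 ≤ B₂') (hBG : 0 ≤ BG) (hBR : 0 ≤ BR) (hγ' : 0 ≤ γ') (hB₀8 : B₀ ≤ B₈)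
    (hγB : 5 * (d : ℝ) * L * B₀ + 2 * (γ' * B₀) ≤ 5 * (d : ℝ) * L * B₈) (hc59 : 0 < c59) :
    ∃ cu cP : ℝ, 0 < cu ∧ 0 < cP ∧
      ∀ (i : ZdIdx d L) (P : ℕ) {Φ : Type*} (Adm : Φ → (Site d → Fin d → 𝔸ˣ) → ℝ → ℝ → Prop)
        (LanF : (Site d → Fin d → 𝔸ˣ) → Φ → ℕ → (Site d → Fin d → 𝔸ˣ) → Prop),
      -- the knit's gauge predicate implies (1.38) at the top level (instance (i) «zero source»: `fun _ _ _ h => h`)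
      (∀ (U₀ : Site d → Fin d → 𝔸ˣ) (φ : Φ) (W : Site d → Fin d → 𝔸ˣ), LanF U₀ φ i.k W → IsLandau138W L i.k i.η (i.Ω 0) (i.Λs i.k) U₀ W) →
      -- the three laws of the periodic (1.5)-index at this member (p. 77 «Ω_j ⊂ T_η», (1.5)–(1.6))
      i.Ω 0 = Set.univ → ((L : ℤ) ^ i.k ∣ (P : ℤ)) →
      (∀ j, j ≤ i.k → ∀ (y : Site d) (ι : Fin d), y + ((P : ℤ) / (L : ℤ) ^ j) • e ι ∈ i.Λs i.k j ↔ y ∈ i.Λs i.k j) →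
      -- (a) ONE SUPPLIER of [4]'s uniqueness letters at `(i.k, i.Λs i.k, U₀)` for unitary `P`-PERIODIC backgrounds in the regime `α₀ ≤ c_L`
      (∀ α₀ : ℝ, 0 < α₀ → α₀ ≤ cL → ∀ U₀ : Site d → Fin d → 𝔸ˣ, (∀ x κ, U₀ x κ ∈ unitaryUnits 𝔸) → IsPeriodic P U₀ → InAk L i.k i.η α₀ i.Ω U₀ →
        ∃ (g Δ : (Site d → 𝔸) →ₗ[ℂ] (Site d → 𝔸)) (q : (Site d → 𝔸) →ₗ[ℂ] (ℕ → Site d → 𝔸)) (qs : (ℕ → Site d → 𝔸) →ₗ[ℂ] (Site d → 𝔸))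
          (Aw c : (ℕ → Site d → 𝔸) →ₗ[ℂ] (ℕ → Site d → 𝔸)) (H' : XSpace d i.k 𝔸 →ₗ[ℂ] (Site d → 𝔸)),
          (∀ x : Site d → 𝔸, (∀ (z : Site d) (ι : Fin d), x (z + (P : ℤ) • e ι) = x z) → (∃ C : ℝ, ∀ y, ‖x y‖ ≤ C) →
            g (Δ x + qs (Aw (q x))) = x) ∧
          (∀ φ : ℕ → Site d → 𝔸, (∀ j, j ≤ i.k → ∀ (y : Site d) (ι : Fin d), φ j (y + ((P : ℤ) / (L : ℤ) ^ j) • e ι) = φ j y) →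
            qs (c (q (g (g (qs φ))))) = qs φ) ∧
          (∀ (f : Site d → 𝔸), ∀ x ∈ i.Ω 0, Δ f x = covLap i.η U₀ ((i.Ω 0).indicator f) x) ∧
          (∀ (μ : ℕ → Site d → 𝔸), ∀ x ∈ i.Ω 0, qs μ x = QT L i.k (i.Λs i.k) U₀ μ x) ∧
          (∀ (f : Site d → 𝔸) (j : ℕ), j ≤ i.k → ∀ y ∈ i.Λs i.k j, q f j y = QprimeIter (zdBlocking d L) (bgT L U₀) j f y) ∧
          (∀ (f : Site d → 𝔸) (j : ℕ) (y : Site d), ¬ (j ≤ i.k ∧ y ∈ i.Λs i.k j) → q f j y = 0) ∧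
          (∀ (f : Site d → 𝔸) (z : Site d) (ι : Fin d), g f (z + (P : ℤ) • e ι) = g f z) ∧
          (∀ μ : ℕ → Site d → 𝔸, ∀ j, j ≤ i.k → ∀ (y : Site d) (ι : Fin d), Aw μ j (y + ((P : ℤ) / (L : ℤ) ^ j) • e ι) = Aw μ j y) ∧
          (∀ (X : XSpace d i.k 𝔸) (x : Site d), ‖H' X x‖ ≤ B₀'H * ‖X‖) ∧
          (∀ j, j ≤ i.k → ∀ (X : XSpace d i.k 𝔸), ∀ p ∈ {b : Site d × Fin d | SideTouches (i.Ω j) b.1 b.2},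
            wt L i.η j * ‖covDerivFwd i.η U₀ p.2 (H' X) p.1‖ ≤ B₀'H * ‖X‖) ∧
          (∀ X : XSpace d i.k 𝔸, Bd2 L i.η i.k i.Ω (covLap i.η U₀ (H' X)) (B₂' * ‖X‖)) ∧
          (∀ X : XSpace d i.k 𝔸, (∀ (p : Fin (i.k + 1) × Site d) (ι : Fin d), X (p.1, p.2 + ((P : ℤ) / (L : ℤ) ^ (p.1 : ℕ)) • e ι) = X p) →
            ∀ (z : Site d) (ι : Fin d), H' X (z + (P : ℤ) • e ι) = H' X z) ∧
          (∀ (Y : XSpace d i.k 𝔸), (∀ (p : Fin (i.k + 1) × Site d) (ι : Fin d), Y (p.1, p.2 + ((P : ℤ) / (L : ℤ) ^ (p.1 : ℕ)) • e ι) = Y p) →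
            ∀ (j : ℕ) (hj : j ≤ i.k) (y : Site d), y ∈ i.Λs i.k j →
            QprimeIter (zdBlocking d L) (bgT L U₀) j (H' Y) y = Y (⟨j, Nat.lt_succ_of_le hj⟩, y)) ∧
          (∀ (f : Site d → 𝔸) (r : ℝ), 0 ≤ r → Bd2 L i.η i.k i.Ω f r →
            (∀ x, ‖g f x‖ ≤ BG * r) ∧ ∀ j, j ≤ i.k → ∀ p ∈ {b : Site d × Fin d | SideTouches (i.Ω j) b.1 b.2},
              wt L i.η j * ‖covDerivFwd i.η U₀ p.2 (g f) p.1‖ ≤ BG * r) ∧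
          (∀ (f : Site d → 𝔸) (r : ℝ), 0 ≤ r → Bd2 L i.η i.k i.Ω f r → Bd2 L i.η i.k i.Ω (f - g (qs (c (q (g f))))) (BR * r))) →
      -- (b) T5's OWN guarded sourced b9 socket text `SH59src` at `(i, P)` below `c₅₉`
      (∀ α₀ α₁ : ℝ, 0 < α₀ → 0 < α₁ → α₀ + α₁ ≤ c59 →
        ∀ U₀ U' : Site d → Fin d → 𝔸ˣ, (∀ x κ, U₀ x κ ∈ unitaryUnits 𝔸) → (∀ x κ, U' x κ ∈ unitaryUnits 𝔸) →
        IsPeriodic P U₀ → IsPeriodic P U' → ∀ φ : Φ, Adm φ U₀ α₀ α₁ →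
        InAk L i.k i.η α₀ i.Ω U₀ → InAk L i.k i.η α₀ i.Ω (mulCfg U' U₀) → (∀ m, m ≤ i.k → InAx L m (i.Λs m) U₀ (mulCfg U' U₀)) →
        (∀ j, j ≤ i.k → ∀ (z : Site d) (μ : Fin d),
          ((∀ x, InBox (tlo L z j) (thi L z j) x → x ∈ i.Ω j) ∨ (∀ x, InBox (tlo L (z + e μ) j) (thi L (z + e μ) j) x → x ∈ i.Ω j)) →
          ‖(avgIter L (mulCfg U' U₀) j z μ : 𝔸) - (avgIter L U₀ j z μ : 𝔸)‖ ≤ α₁) →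
        (∀ b ∈ {b : Site d × Fin d | SideTouches (i.Ω 0) b.1 b.2}, ‖((U' b.1 b.2 : 𝔸ˣ) : 𝔸) - 1‖ ≤ α₁) →
        (∀ m, 1 ≤ m → m ≤ i.k → ∀ (u : Site d → 𝔸ˣ) (W : Site d → Fin d → 𝔸ˣ) (A' : Site d → Fin d → 𝔸),
          (∀ x, u x ∈ unitaryUnits 𝔸) → IsPeriodic P u → IsPeriodic P W → IsPeriodic P A' →
          mgauge U₀ u W = U' → Restr129 L m (i.Λs m) U₀ u → LanF U₀ φ m W →
          (∀ y τ, IsSelfAdjoint (A' y τ)) →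
          (∀ j, j ≤ m → ∀ y τ, SideTouches (i.Ω j) y τ →
          W y τ = cfgExp i.η A' y τ ∧ ‖A' y τ‖ ≤ (2 * (L * (5 * (d : ℝ) * L * B₈ * (α₀ + α₁))) + 8 * (8 * B₀' * (5 * (d : ℝ) * L * B₈) * (α₀ + α₁))) * ((L : ℝ) ^ j * i.η)⁻¹) →
          (∀ y τ, (∀ j, j ≤ m → ¬ SideTouches (i.Ω j) y τ) → A' y τ = 0) →
          msup L m i.η (-(1 : ℝ)) (fun j (b : Site d × Fin d) => SideTouches (i.Ω j) b.1 b.2) (fun b => A' b.1 b.2)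
          ≤ B₀ * (bondNorm L m i.η (-(3 : ℝ)) i.Ω (fun x μ => Jcur i.η U₀ A' μ x)
          + wsup 1 (fun p : {p : ℕ × (Site d × Fin d) // p.1 ≤ m ∧ p.2 ∈ towerBondsP L i.Ω (i.Λs m) p.1} =>
          linCovIter L U₀ (iEta i.η A') p.1.1 p.1.2.1 p.1.2.2)) + γ' * B₀ * (α₀ + α₁) ∧
          msup L m i.η (-(2 : ℝ)) (fun j (t : Fin d × Fin d × Site d) => SideTouches (i.Ω j) t.2.2 t.2.1)
          (fun t => covDerivFwd i.η U₀ t.1 (fun z => A' z t.2.1) t.2.2)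
          ≤ B₀ * (bondNorm L m i.η (-(3 : ℝ)) i.Ω (fun x μ => Jcur i.η U₀ A' μ x)
          + wsup 1 (fun p : {p : ℕ × (Site d × Fin d) // p.1 ≤ m ∧ p.2 ∈ towerBondsP L i.Ω (i.Λs m) p.1} =>
          linCovIter L U₀ (iEta i.η A') p.1.1 p.1.2.1 p.1.2.2)) + γ' * B₀ * (α₀ + α₁))) →
      -- T5's `SP5u` binder text at `(i, P)`
      ∀ α₀ α₁ : ℝ, 0 < α₀ → 0 < α₁ → α₀ + α₁ ≤ cP →
        ∀ U₀ U' : Site d → Fin d → 𝔸ˣ, (∀ x κ, U₀ x κ ∈ unitaryUnits 𝔸) → (∀ x κ, U' x κ ∈ unitaryUnits 𝔸) →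
        IsPeriodic P U₀ → IsPeriodic P U' → ∀ φ : Φ, Adm φ U₀ α₀ α₁ →
        InAk L i.k i.η α₀ i.Ω U₀ → InAk L i.k i.η α₀ i.Ω (mulCfg U' U₀) → (∀ m, m ≤ i.k → InAx L m (i.Λs m) U₀ (mulCfg U' U₀)) →
        (∀ j, j ≤ i.k → ∀ (z : Site d) (μ : Fin d),
          ((∀ x, InBox (tlo L z j) (thi L z j) x → x ∈ i.Ω j) ∨ (∀ x, InBox (tlo L (z + e μ) j) (thi L (z + e μ) j) x → x ∈ i.Ω j)) →
          ‖(avgIter L (mulCfg U' U₀) j z μ : 𝔸) - (avgIter L U₀ j z μ : 𝔸)‖ ≤ α₁) →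
        (∀ b ∈ {b : Site d × Fin d | SideTouches (i.Ω 0) b.1 b.2}, ‖((U' b.1 b.2 : 𝔸ˣ) : 𝔸) - 1‖ ≤ α₁) →
        ∀ u₁ : Site d → 𝔸ˣ, (∀ x, u₁ x ∈ unitaryUnits 𝔸) → (∀ x, x ∉ i.Ω 0 → u₁ x = 1) → IsPeriodic P u₁ → Restr129 L i.k (i.Λs i.k) U₀ u₁ →
        LanF U₀ φ i.k (mgauge U₀ u₁⁻¹ U') →
        (∃ A₁ : Site d → Fin d → 𝔸, ∀ j, j ≤ i.k → ∀ (x : Site d) (κ : Fin d), SideTouches (i.Ω j) x κ →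
          mgauge U₀ u₁⁻¹ U' x κ = cfgExp i.η A₁ x κ ∧ ‖A₁ x κ‖ ≤ (5 * (d : ℝ) * L * B₈ * (α₀ + α₁)) * ((L : ℝ) ^ j * i.η)⁻¹) →
        ∀ (v w : Site d → 𝔸ˣ) (lam mu : Site d → 𝔸),
        IsPeriodic P v → IsPeriodic P w → IsPeriodic P lam → IsPeriodic P mu →
        (∀ x, ((gaugeExp lam x : 𝔸ˣ) : 𝔸) = ((v x : 𝔸ˣ) : 𝔸) ∧ IsSelfAdjoint (lam x) ∧ ‖lam x‖ < cu) → (∀ x, x ∉ i.Ω 0 → lam x = 0) →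
        (∀ j, j ≤ i.k → ∀ b ∈ {b : Site d × Fin d | SideTouches (i.Ω j) b.1 b.2}, ((L : ℝ) ^ j * i.η) * ‖covDerivFwd i.η U₀ b.2 lam b.1‖ < cu) →
        (∀ x, ((gaugeExp mu x : 𝔸ˣ) : 𝔸) = ((w x : 𝔸ˣ) : 𝔸) ∧ IsSelfAdjoint (mu x) ∧ ‖mu x‖ < cu) → (∀ x, x ∉ i.Ω 0 → mu x = 0) →
        (∀ j, j ≤ i.k → ∀ b ∈ {b : Site d × Fin d | SideTouches (i.Ω j) b.1 b.2}, ((L : ℝ) ^ j * i.η) * ‖covDerivFwd i.η U₀ b.2 mu b.1‖ < cu) →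
        LanF U₀ φ i.k (mgauge U₀ v⁻¹ (mgauge U₀ u₁⁻¹ U')) → Restr129 L i.k (i.Λs i.k) U₀ (u₁ * v) →
        LanF U₀ φ i.k (mgauge U₀ w⁻¹ (mgauge U₀ u₁⁻¹ U')) → Restr129 L i.k (i.Λs i.k) U₀ (u₁ * w) →
        ∀ x, v x = w x := by
  have hL1 : 1 ≤ L := le_trans (by norm_num) hL
  have hd1 : 1 ≤ d := le_trans (by norm_num) hd2
  have hB₈ : 0 < B₈ := lt_of_lt_of_le hB₀ hB₀8
  -- the uniqueness windows at source size `0` (member-uniform): radius `α₄`, domain `c_u`, threshold `c_W`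
  obtain ⟨α₄, cu, cW, hα₄, hcu, hcW, hW⟩ := uniqWindows_of_guard_src hd1 hL1 hB₈ hB hB₀'H hB₂' hBG hBR (le_refl (0 : ℝ))
  -- EDITION γ: the five γ windows from one more member-uniform threshold `c_γ(d, L, B₈)`
  obtain ⟨cγ, hcγ, hWγ⟩ := gammaWindows_of_guard (d := d) hd1 hL1 hB₈
  refine ⟨cu, min cW (min cL (min c59 cγ)), hcu, lt_min hcW (lt_min hcL (lt_min hc59 hcγ)), ?_⟩
  intro i P Φ Adm LanF hLan138 hΩ0 hPdiv hΛ SLetUBper SH59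
  have hPW : min cW (min cL (min c59 cγ)) ≤ cW := min_le_left _ _
  have hPL : min cW (min cL (min c59 cγ)) ≤ cL := (min_le_right _ _).trans (min_le_left _ _)
  have hP59 : min cW (min cL (min c59 cγ)) ≤ c59 := (min_le_right _ _).trans ((min_le_right _ _).trans (min_le_left _ _))
  have hPγ : min cW (min cL (min c59 cγ)) ≤ cγ := (min_le_right _ _).trans ((min_le_right _ _).trans (min_le_right _ _))
  exact sp5u_of_lettersUB_γ'_per hd2 hL i.hη i.hk P i.hΩ hΩ0 (B8TowerBondsPrinted.ZdIdx.towerBondsP_laws i).1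
    (B8TowerBondsPrinted.ZdIdx.towerBondsP_laws i).2 i.htower hPdiv hΛ hB₀ hB₀' hB₀'H hB₂' hBG hBR hγ' hB₀8 hγB hα₄ SLetUBper hPL Adm LanF hLan138
    (fun α₀ α₁ hα₀ hα₁ hs => SH59 α₀ α₁ hα₀ hα₁ (hs.trans hP59))
    (fun α₀ α₁ hα₀ hα₁ hs cs cB cDA hE hE₂ lE lE₂ h1 h2 h3 h4 h5 h6 h7 => by
      have h := hW α₀ α₁ hα₀ hα₁ (hs.trans hPW) cs cB cDA hE hE₂ lE lE₂ h1 h2 h3 h4 h5 h6 h7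
      simp only [zero_mul, zero_div, add_zero] at h
      exact h)
    (fun α₀ α₁ hα₀ hα₁ hs => hWγ α₀ α₁ hα₀ hα₁ (hs.trans hPγ))

end Server

#print axioms sp5u_of_lettersUB_γ'_per
#print axioms sockP5uPer_of_lettersAtPerNested

end Literature.MathematicalPhysics.QuantumFieldTheory.Balaban1983to89.B8SockSP5uNestedPer

end
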